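import Mathlib
import Literature.Analysis.ODE.MaximalTime
import Literature.Barriers.NavierStokesRegularity.DyadicInvariantRegion
import Summits.NavierStokesRegularity.NavierStokesRegularity.Theorems.OrthantWakeDyadicBreakBelowOneRegionTools
import HarnessLib

/-!
# `OrthantWake.DyadicBreakBelowOne` — a Barbato–Morandin-type cubic 2-mode invariant region for the
# INFINITE weighted chain at an arbitrary shell ratio (first-exit argument, abstract certificate)

Item stmt-NavierStokesRegularity-24644 (`OrthantWake.DyadicBreakBelowOne`, aside).  The dynamical
half of a BMR-type certificate at a general shell ratio, for the infinite lattice on a window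
`[0,s]` (no Galerkin truncation: the deep shells are kept inside `[0,δ]` by an a-priori smallness
hypothesis, which for the tree's regular lattice solutions is Tao's weight bound (4.5)):

* `dyadicRegion_le_one` — let `Y₀ ≡ 0` and let continuous non-negative `Y₁, Y₂, …` on `[0,s]` have
  right derivatives `Ẏₙ = -κₙ Yₙ + Fₙ (Y_{n-1}² - D Yₙ Y_{n+1})` on `[0,s)` with `0 < κₙ ≤ κ_{n+1} ≤ V κₙ`,
  `0 < Fₙ`, `F_{n+1} = K Fₙ`; let the cubic region `A = {0 ≤ x ≤ 1, h(x) ≤ y ≤ m x + θ}`,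
  `h(x) = c((x−δ)/(1−δ))³` (`x > δ`), `0` (`x ≤ δ`), satisfy the corner condition `D c ≥ 1`, the
  viscous star-shape condition `V(1−δ) ≤ 3`, `0 < δ < θ ≤ 1`, `0 < c`, `m ≥ 0`, and the two
  CERTIFICATE inequalities (`hψ₁` on the slanted piece, `hψ₂` on the curved piece); if every mode
  starts in `[0,δ]` and the modes beyond `N₀` stay in `[0,δ]` on `[0,s]`, then `Yₙ(t) ≤ 1` for all
  `n` and `t ∈ [0,s]`.

PROOF = the tree's first-exit proof of BMR's Lemma 2.1
(`Literature.Barriers.NavierStokesRegularity.Dyadic.invariantRegion_le_one`, base `2`, truncated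
system) run on the finitely many pairs `n ∈ [1, N₀]` of the infinite chain: the constraint predicate
is closed (continuity), holds at `t = 0`, and at the maximal time `T < s` every active constraint
has a strictly negative right derivative (`dyadicRegion_rhs_neg_at_one`,
`dyadicRegion_top_slant_deriv_neg`, `dyadicRegion_bottom_curve_deriv_neg`,
`dyadicRegion_bottom_corner_deriv_neg`) or is positivity (flat bottom piece); the neighbours of the
last constrained pair are controlled by the smallness of the deep shells.

MODEL lattice bookkeeping (route OrthantWake, rung TL-M2Break); nothing here is a statement about
the Navier–Stokes equations; no crux or summit is proved.
-/

noncomputable section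

set_option linter.dupNamespace false

namespace Summit.NavierStokesRegularity.NavierStokesRegularity.Theorems

open Set Filter Topology
open Literature.Barriers.NavierStokesRegularity.Dyadic

/-- **The cubic 2-mode region at an arbitrary ratio, infinite chain, window `[0,s]`.**  See the
module docstring: under the corner condition `D c ≥ 1`, the star-shape condition `V(1−δ) ≤ 3`, the
certificate inequalities `hψ₁`/`hψ₂`, data in `[0,δ]` and deep shells (`n > N₀`) staying in `[0,δ]`,
every mode of `Ẏₙ = -κₙYₙ + Fₙ(Y_{n-1}² − D YₙY_{n+1})` stays `≤ 1` on `[0,s]`.  First-exit argument on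
the constraints `Yₙ ≤ 1`, `Y_{n+1} ≤ mYₙ + θ`, `h(Yₙ) ≤ Y_{n+1}`, `1 ≤ n ≤ N₀`.  MODEL lattice statement.
[cite: BarbatoMorandinRomito2011, §2 Lemma 2.1] [cite: BarbatoMorandin2012, §5 Thm. 15] -/
theorem dyadicRegion_le_one {Y : ℕ → ℝ → ℝ} {κ F : ℕ → ℝ} {K D V c δ θ m s : ℝ} {N₀ : ℕ}
    (hs : 0 < s)
    (hκ : ∀ n, 0 < κ n) (hκmono : ∀ n, κ n ≤ κ (n + 1)) (hκV : ∀ n, κ (n + 1) ≤ V * κ n)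
    (hF : ∀ n, 0 < F n) (hFK : ∀ n, F (n + 1) = K * F n) (hK : 0 < K)
    (hD : 0 < D) (hc0 : 0 < c) (hDc : 1 ≤ D * c)
    (hδ0 : 0 < δ) (hδθ : δ < θ) (hθ1 : θ ≤ 1) (hm : 0 ≤ m) (hVδ : V * (1 - δ) ≤ 3)
    (hψ₁ : ∀ x : ℝ, 0 ≤ x → m * x + θ ≤ 1 →
      K * (x ^ 2 - D * (m * x + θ) * (c * ((m * x + θ - δ) / (1 - δ)) ^ 3)) +
        m * D * x * (m * x + θ) ≤ 0)
    (hψ₂ : ∀ x : ℝ, δ < x → x ≤ 1 →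
      3 * c * ((x - δ) / (1 - δ)) ^ 2 / (1 - δ) * (1 - D * x * (c * ((x - δ) / (1 - δ)) ^ 3)) -
        K * (x ^ 2 - D * (c * ((x - δ) / (1 - δ)) ^ 3) *
          (m * (c * ((x - δ) / (1 - δ)) ^ 3) + θ)) < 0)
    (hY0 : ∀ t, Y 0 t = 0)
    (hcont : ∀ n, ContinuousOn (Y n) (Icc 0 s))
    (hderiv : ∀ n, 1 ≤ n → ∀ t ∈ Ico (0 : ℝ) s, HasDerivWithinAt (Y n)
      (-κ n * Y n t + F n * (Y (n - 1) t ^ 2 - D * Y n t * Y (n + 1) t)) (Ici t) t)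
    (hpos : ∀ n, ∀ t ∈ Icc (0 : ℝ) s, 0 ≤ Y n t)
    (hsmall : ∀ n, N₀ < n → ∀ t ∈ Icc (0 : ℝ) s, Y n t ≤ δ)
    (hinit : ∀ n, Y n 0 ≤ δ) :
    ∀ n, ∀ t ∈ Icc (0 : ℝ) s, Y n t ≤ 1 := by
  have hδ1 : δ < 1 := hδθ.trans_le hθ1
  have hθ0 : 0 < θ := hδ0.trans hδθ
  have h1δ : 0 < 1 - δ := by linarith
  -- the lower curve
  set h : ℝ → ℝ := fun x => if x ≤ δ then (0 : ℝ) else c * ((x - δ) / (1 - δ)) ^ 3 with hh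
  -- the constraint predicate (pairs `1 ≤ n ≤ N₀`)
  set P : ℝ → Prop := fun t =>
    (∀ n ∈ Finset.Icc 1 N₀, Y n t ≤ 1) ∧
      (∀ n ∈ Finset.Icc 1 N₀, Y (n + 1) t ≤ m * Y n t + θ) ∧
      (∀ n ∈ Finset.Icc 1 N₀, h (Y n t) ≤ Y (n + 1) t) with hP
  -- from `P t` (and smallness) all modes are `≤ 1`
  have hall : ∀ t ∈ Icc (0 : ℝ) s, P t → ∀ n, Y n t ≤ 1 := by
    intro t ht hPt n
    simp only [hP] at hPt
    rcases Nat.eq_zero_or_pos n with rfl | hn1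
    · rw [hY0]; norm_num
    rcases le_or_gt n N₀ with hle | hgt
    · exact hPt.1 n (Finset.mem_Icc.2 ⟨hn1, hle⟩)
    · exact (hsmall n hgt t ht).trans hδ1.le
  suffices key : ∀ t ∈ Icc (0 : ℝ) s, P t from fun n t ht => hall t ht (key t ht) n
  -- `P 0`
  have hP0 : P 0 := by
    simp only [hP]
    have h0s : (0 : ℝ) ∈ Icc (0 : ℝ) s := ⟨le_rfl, hs.le⟩
    refine ⟨fun n _ => (hinit n).trans hδ1.le, fun n _ => ?_, fun n _ => ?_⟩
    · have h1 := hinit (n + 1)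
      have h2 := hpos n 0 h0s
      nlinarith
    · rw [hh]; dsimp only; rw [if_pos (hinit n)]
      exact hpos (n + 1) 0 h0s
  -- the constraints are closed
  have hclosed : ∀ t ∈ Ioc 0 s, (∀ u ∈ Ico 0 t, P u) → P t := by
    intro t ht hPs
    simp only [hP] at hPs ⊢
    refine ⟨fun n hn => ?_, fun n hn => ?_, fun n hn => ?_⟩
    · exact le_of_forall_Ico_le (hcont n) continuousOn_const ht fun u hu => (hPs u hu).1 n hn
    · exact le_of_forall_Ico_le (hcont (n + 1))
        ((continuousOn_const.mul (hcont n)).add continuousOn_const) ht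
        fun u hu => (hPs u hu).2.1 n hn
    · exact le_of_forall_Ico_le ((dyadicRegion_continuous_curve hδ1 c).comp_continuousOn (hcont n))
        (hcont (n + 1)) ht fun u hu => (hPs u hu).2.2 n hn
  -- the maximal time
  set T := Literature.Analysis.ODE.maximalTimeP P 0 s with hT
  have hTmem : T ∈ Icc 0 s := Literature.Analysis.ODE.maximalTimeP_mem hs.le hP0
  have hPT : ∀ t ∈ Icc 0 T, P t := fun t ht =>
    Literature.Analysis.ODE.maximalTimeP_spec hs.le hP0 hclosed ht
  by_contra hcon
  have hTb : T < s := by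
    rcases lt_or_eq_of_le hTmem.2 with hlt | heq
    · exact hlt
    · exact absurd (fun t ht => hPT t (heq ▸ ht)) hcon
  have hT0 : 0 ≤ T := hTmem.1
  have hTs : T ∈ Icc (0 : ℝ) s := ⟨hT0, hTb.le⟩
  -- the state at time `T`
  have hPτ := hPT T ⟨hT0, le_rfl⟩
  have hle1 : ∀ k, Y k T ≤ 1 := hall T hTs hPτ
  simp only [hP] at hPτ
  obtain ⟨hR, hTop, hBot⟩ := hPτ
  have hposT : ∀ k, 0 ≤ Y k T := fun k => hpos k T hTs
  -- the upper neighbour is at most `m Y + θ` (every pair with `k ≥ 1`)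
  have hupp : ∀ k, 1 ≤ k → Y (k + 1) T ≤ m * Y k T + θ := by
    intro k hk1
    rcases le_or_gt k N₀ with hle | hgt
    · exact hTop k (Finset.mem_Icc.2 ⟨hk1, hle⟩)
    · have h1 := hsmall (k + 1) (by omega) T hTs
      have h2 := hposT k
      nlinarith
  -- the upper neighbour is at least `h` of the mode (every pair with `k ≥ 1`)
  have hlow : ∀ k, 1 ≤ k → h (Y k T) ≤ Y (k + 1) T := by
    intro k hk1
    rcases le_or_gt k N₀ with hle | hgt
    · exact hBot k (Finset.mem_Icc.2 ⟨hk1, hle⟩)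
    · rw [hh]; dsimp only; rw [if_pos (hsmall k hgt T hTs)]
      exact hposT (k + 1)
  have hlow' : ∀ k, 1 ≤ k → δ < Y k T →
      c * ((Y k T - δ) / (1 - δ)) ^ 3 ≤ Y (k + 1) T := by
    intro k hk1 hkδ
    have := hlow k hk1
    rw [hh] at this; dsimp only at this
    rwa [if_neg (not_le.2 hkδ)] at this
  -- neighbourhood facts at `T`
  have hIcc : Icc 0 s ∈ 𝓝[Ici T] T :=
    mem_of_superset (Icc_mem_nhdsGE hTb) (Icc_subset_Icc hT0 le_rfl)
  have hcw : ∀ k, ContinuousWithinAt (Y k) (Ici T) T := fun k =>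
    (hcont k T hTs).mono_of_mem_nhdsWithin hIcc
  -- derivatives at `T`
  have hd : ∀ k, 1 ≤ k → HasDerivWithinAt (Y k)
      (-κ k * Y k T + F k * (Y (k - 1) T ^ 2 - D * Y k T * Y (k + 1) T)) (Ici T) T :=
    fun k hk1 => hderiv k hk1 T ⟨hT0, hTb⟩
  ------------------------------------------------------------------
  -- (R) the constraints `Yₙ ≤ 1` persist
  ------------------------------------------------------------------
  have evR : ∀ n ∈ Finset.Icc 1 N₀, ∀ᶠ t in 𝓝[Ici T] T, Y n t ≤ 1 := by
    intro n hn
    obtain ⟨hn1, _hnN⟩ := Finset.mem_Icc.1 hn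
    rcases lt_or_eq_of_le (hle1 n) with hlt | heq
    · exact ((hcw n).eventually_lt_const hlt).mono fun t ht => ht.le
    · have hφ := (hd n hn1).sub_const 1
      have hz : c ≤ Y (n + 1) T := by
        have := hlow' n hn1 (by rw [heq]; exact hδ1)
        rwa [heq, dyadicRegion_curve_one hδ1] at this
      have hneg : -κ n * Y n T + F n * (Y (n - 1) T ^ 2 - D * Y n T * Y (n + 1) T) < 0 := by
        rw [heq]
        exact dyadicRegion_rhs_neg_at_one (hκ n) (hF n).le hD.le hDc (hposT (n - 1))
          (hle1 (n - 1)) hz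
      exact (eventually_nonpos_of_hasDerivWithinAt_neg hφ hneg (by simp [heq])).mono
        fun t ht => by linarith
  ------------------------------------------------------------------
  -- (T) the constraints `Y_{n+1} ≤ m Yₙ + θ` persist
  ------------------------------------------------------------------
  have evT : ∀ n ∈ Finset.Icc 1 N₀, ∀ᶠ t in 𝓝[Ici T] T,
      Y (n + 1) t ≤ m * Y n t + θ := by
    intro n hn
    obtain ⟨hn1, _hnN⟩ := Finset.mem_Icc.1 hn
    rcases lt_or_eq_of_le (hupp n hn1) with hlt | heq
    · have hc2 : ContinuousWithinAt (fun t => Y (n + 1) t - (m * Y n t + θ)) (Ici T) T :=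
        (hcw (n + 1)).sub ((continuousWithinAt_const.mul (hcw n)).add continuousWithinAt_const)
      have hlt' : Y (n + 1) T - (m * Y n T + θ) < 0 := by linarith
      exact (hc2.eventually_lt_const hlt').mono
        fun t (ht : Y (n + 1) t - (m * Y n t + θ) < 0) => by linarith
    · -- active constraint: the derivative is strictly negative (piece `n₂`)
      have hdn := hd n hn1
      have hdn1 := hd (n + 1) (by omega)
      simp only [Nat.add_sub_cancel] at hdn1
      have hφ := hdn1.sub ((hdn.const_mul m).add_const θ)
      have hy1 : Y (n + 1) T ≤ 1 := hle1 (n + 1)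
      have hyδ : δ < Y (n + 1) T := by rw [heq]; nlinarith [hposT n]
      have hz := hlow' (n + 1) (by omega) hyδ
      have hmx1 : m * Y n T + θ ≤ 1 := heq ▸ hy1
      have hψ := hψ₁ (Y n T) (hposT n) hmx1
      have hneg : (-κ (n + 1) * Y (n + 1) T +
            F (n + 1) * (Y n T ^ 2 - D * Y (n + 1) T * Y (n + 1 + 1) T)) -
          m * (-κ n * Y n T + F n * (Y (n - 1) T ^ 2 - D * Y n T * Y (n + 1) T)) < 0 := by
        rw [hFK n]
        have := dyadicRegion_top_slant_deriv_neg (hκ n) (hκmono n) (hF n) hK.le hD.le hm hθ0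
          (hposT n) heq hz (w := Y (n - 1) T) (by rw [heq]; exact hψ)
        convert this using 2
      have h0 : Y (n + 1) T - (m * Y n T + θ) ≤ 0 := by linarith
      exact (eventually_nonpos_of_hasDerivWithinAt_neg hφ hneg h0).mono
        fun t (ht : Y (n + 1) t - (m * Y n t + θ) ≤ 0) => by linarith
  ------------------------------------------------------------------
  -- (B) the constraints `h(Yₙ) ≤ Y_{n+1}` persist
  ------------------------------------------------------------------
  have evB : ∀ n ∈ Finset.Icc 1 N₀, ∀ᶠ t in 𝓝[Ici T] T, h (Y n t) ≤ Y (n + 1) t := by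
    intro n hn
    obtain ⟨hn1, _hnN⟩ := Finset.mem_Icc.1 hn
    by_cases hxδ : Y n T < δ
    · -- flat bottom piece: `h ≡ 0` and positivity (inside the window)
      have ev1 : ∀ᶠ t in 𝓝[Ici T] T, Y n t < δ := (hcw n).eventually_lt_const hxδ
      filter_upwards [ev1, hIcc] with t ht hts
      rw [hh]; dsimp only; rw [if_pos ht.le]
      exact hpos (n + 1) t hts
    · push Not at hxδ
      rcases lt_or_eq_of_le (hlow n hn1) with hlt | heq
      · have hc2 : ContinuousWithinAt (fun t => h (Y n t) - Y (n + 1) t) (Ici T) T :=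
          (((dyadicRegion_continuous_curve hδ1 c).continuousAt).comp_continuousWithinAt
            (hcw n)).sub (hcw (n + 1))
        have hlt' : h (Y n T) - Y (n + 1) T < 0 := by linarith
        exact (hc2.eventually_lt_const hlt').mono fun t ht => by linarith
      · -- active constraint on the bottom piece
        have hdn := hd n hn1
        have hdn1 := hd (n + 1) (by omega)
        simp only [Nat.add_sub_cancel] at hdn1
        have hchain := (dyadicRegion_hasDerivAt_curve hδ1 c (Y n T)).comp_hasDerivWithinAt T hdn
        have hφ := hchain.sub hdn1
        have h0 : h (Y n T) - Y (n + 1) T ≤ 0 := by rw [heq]; simp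
        rcases eq_or_lt_of_le hxδ with hxeq | hxgt
        · -- the corner `x = δ`: `h = h' = 0`, `Y_{n+1} = 0`
          have hy0 : Y (n + 1) T = 0 := by
            rw [← heq, hh]; dsimp only; rw [if_pos hxeq.symm.le]
          have hneg : (if Y n T ≤ δ then (0 : ℝ)
                else 3 * c * ((Y n T - δ) / (1 - δ)) ^ 2 / (1 - δ)) *
                (-κ n * Y n T + F n * (Y (n - 1) T ^ 2 - D * Y n T * Y (n + 1) T)) -
              (-κ (n + 1) * Y (n + 1) T +
                F (n + 1) * (Y n T ^ 2 - D * Y (n + 1) T * Y (n + 1 + 1) T)) < 0 := by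
            rw [if_pos hxeq.symm.le, hy0, ← hxeq]
            exact dyadicRegion_bottom_corner_deriv_neg (hF (n + 1)) hδ0.ne'
          exact (eventually_nonpos_of_hasDerivWithinAt_neg hφ hneg h0).mono fun t ht => by
            simpa [Function.comp, hh] using ht
        · -- `x > δ`: piece `n₅`
          have hy : Y (n + 1) T = c * ((Y n T - δ) / (1 - δ)) ^ 3 := by
            rw [← heq, hh]; dsimp only; rw [if_neg (not_le.2 hxgt)]
          have hx1 : Y n T ≤ 1 := hle1 n
          have hzupp := hupp (n + 1) (by omega)
          have hψ := hψ₂ (Y n T) hxgt hx1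
          have hneg : (if Y n T ≤ δ then (0 : ℝ)
                else 3 * c * ((Y n T - δ) / (1 - δ)) ^ 2 / (1 - δ)) *
                (-κ n * Y n T + F n * (Y (n - 1) T ^ 2 - D * Y n T * Y (n + 1) T)) -
              (-κ (n + 1) * Y (n + 1) T +
                F (n + 1) * (Y n T ^ 2 - D * Y (n + 1) T * Y (n + 1 + 1) T)) < 0 := by
            rw [if_neg (not_le.2 hxgt), hFK n]
            have := dyadicRegion_bottom_curve_deriv_neg (hκ n).le (hκV n) hVδ (hF n) hK.le hD.le
              hc0.le hδ0.le hδ1 hxgt.le hx1 hy hzupp (hposT (n - 1)) (hle1 (n - 1))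
              (by rw [hy]; exact hψ)
            convert this using 2
          exact (eventually_nonpos_of_hasDerivWithinAt_neg hφ hneg h0).mono fun t ht => by
            simpa [Function.comp, hh] using ht
  ------------------------------------------------------------------
  -- exit: `P` holds eventually at `T` within `[0, s]`, contradicting `T < s`
  ------------------------------------------------------------------
  have hright : ∀ᶠ t in 𝓝[Ici T] T, P t := by
    have e1 := (Filter.eventually_all_finset _).2 evR
    have e2 := (Filter.eventually_all_finset _).2 evT
    have e3 := (Filter.eventually_all_finset _).2 evB
    filter_upwards [e1, e2, e3] with t h1 h2 h3
    simp only [hP]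
    exact ⟨h1, h2, h3⟩
  exact Literature.Analysis.ODE.not_eventually_of_maximalTimeP_lt hs.le hP0 hTb
    (eventually_nhdsWithin_Icc_of_left_of_right hPT hright)

end Summit.NavierStokesRegularity.NavierStokesRegularity.Theorems

end
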